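import Summits.BirchSwinnertonDyer.Rank1Residual.ManinAdditive.ShimuraKernel
import Summits.BirchSwinnertonDyer.BirchSwinnertonDyer.Theses.ManinLocalTwoThree
import Summits.BirchSwinnertonDyer.BirchSwinnertonDyer.Theorems.ManinLocalTwoThreeShimuraQuotientRational
import HarnessLib

/-!
# THE SHIMURA-KERNEL SPLIT OF C2 — the route declaration BY NAME and the locus theorems modulo F★
# (cell `bsd-f2-manin`, planner `an` g33, MEMO-an §76; TURNKEY-an-27 file (b); nothing asserted about C2)

TYPER NOTE (typer g18, TURNKEY-an-27 (b)).  The CONE LEAF complementing the route-independent `ShimuraKernel.lean`: the four theorems of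
HOME/an/g33/Sketch-an-g33.lean sha16 a6fc19f06f502f50 that either name the route declaration
`Summit.BirchSwinnertonDyer.BirchSwinnertonDyer.Theses.ManinLocalTwoThree.ManinOddAtFour` (crux C2, stmt-BirchSwinnertonDyer-22967) or need
`Theorems.ManinLocalTwoThreeShimuraQuotientRational` (inside the Theses cone), VERBATIM: `maninOddAtFour_of_body` (§0), **`maninOddAtFour_of_transfer_of_gammaOneOddAtFour`**
(§2: F-need → E-an-151 → es E-es-112 → C2, the route decl BY NAME), `transfer_of_not_hasNonBlind` and `maninOdd_iff_gammaOneOdd_of_not_hasNonBlind`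
(§4: E-an-151 is ALREADY a theorem off the locus «`W₀` has a NON-blind rational 2-torsion point», modulo the cusp-rationality fact F★
`optimalGamma1Parametrization_cusp_rational`, one line from the LEAD's `shimuraLedgerAtFour_of_cusp_rational` p690296 — so the OPEN content of
E-an-151 is exactly the X₀-certificate's locus, MEMO-an §56).  an asked for this part under `…/BirchSwinnertonDyer/Theorems/` with `--supports`
(crux evidence); `Theorems/` is prover-only for the typer seat and `--supports` is refused for `Rank1Residual/ManinAdditive/` targets, so it lands
here as a deliberate cone leaf (precedent: `MinusOneLevelRaisingManinOddAtFourSplit.lean`, `MinusOneLevelRaisingSixteenSplit.lean`) with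
«bears_on: stmt-BirchSwinnertonDyer-22967» in the proposal note; the C2 LEAD cites the declarations by name.  Theorems only; 0 sorry; no new fact.
HONEST FRAMING: implications between obligation nodes and one route declaration; nothing asserts C2, Manin's conjecture or BSD.  PARTITION 0;
beyond-print theorem: NO.  BSD is not proved by this; C2/C3 OPEN.
[cite: Stevens1989, §2 (shape only)] [cite: ConradEdixhovenStein2003, §6.1.2 and §6.2 (the cuspidal subgroup / Shimura subgroup over ℤ; shape of F★'s use)]
-/

set_option autoImplicit false

noncomputable section

open WeierstrassCurve Literature.NumberTheory.EllipticCurves Literature.NumberTheory.EllipticCurves.ModularForms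
open CongruenceSubgroup
open Summit.BirchSwinnertonDyer.Rank1Residual.ManinAdditive.ShimuraLedger
open Summit.BirchSwinnertonDyer.Rank1Residual.ManinAdditive.CuspidalKummer
open Summit.BirchSwinnertonDyer.Rank1Residual.ManinAdditive.KatoCurve
open Summit.BirchSwinnertonDyer.BirchSwinnertonDyer.Theorems.ManinLocalTwoThree

namespace Summit.BirchSwinnertonDyer.Rank1Residual.ManinAdditive.ShimuraKernel

/-! ## §0/§2 — the route declaration C2 `ManinOddAtFour` BY NAME -/

/-- The body gives the route decl C2 (ignore the four fact hypotheses). -/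
theorem maninOddAtFour_of_body (h : ManinOddAtFourBody) :
    Summit.BirchSwinnertonDyer.BirchSwinnertonDyer.Theses.ManinLocalTwoThree.ManinOddAtFour :=
  fun _ _ _ _ ↦ h

/-- **C2 ⟸ F-need ∧ E-an-151 ∧ E-es-112** (the route decl, by name). -/
theorem maninOddAtFour_of_transfer_of_gammaOneOddAtFour (hex : exists_optimal_gamma1ParametrizationData)
    (h151 : GammaOneTransferAtFour) (h112 : GammaOneOddAtFour) :
    Summit.BirchSwinnertonDyer.BirchSwinnertonDyer.Theses.ManinLocalTwoThree.ManinOddAtFour :=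
  maninOddAtFour_of_body
    (body_of_transfer_of_gammaOneOdd hex h151 (gammaOneOddOfClassAtFour_of_gammaOneOddAtFour h112))

/-! ## §4 What is already a theorem: E-an-151 off the non-blind locus (mod F★; the index-1 case is in `ShimuraKernel.lean`) -/

/-- **E-an-151 holds whenever `W₀` has NO non-blind rational `2`-torsion point** (`a₁ = a₃ = 0` models), modulo the
cusp-rationality fact F★ — one line from the LEAD's `shimuraLedgerAtFour_of_cusp_rational`.  So the OPEN content of
E-an-151 is exactly the locus of the X₀-certificate (MEMO-an §56: a non-blind rational `2`-torsion point on `E₀`).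
[cite: ConradEdixhovenStein2003, §6.1.2 and §6.2] -/
theorem transfer_of_not_hasNonBlind (hF : optimalGamma1Parametrization_cusp_rational)
    {W₁ W₀ : WeierstrassCurve ℚ} [W₁.IsElliptic] [W₁.IsGloballyMinimal] [W₀.IsElliptic] [W₀.IsGloballyMinimal]
    {N : ℕ} [NeZero N] (D₁ : Gamma1ParametrizationData W₁ N) (D₀ : ModularParametrizationData W₀ N)
    (hiso : IsIsogenous W₁ W₀) (h₁ : D₁.IsOptimal)
    (h₀ : ∀ z ∈ D₀.L.lattice, ∃ w ∈ periodLattice D₀.f, z = D₀.c * w) (h4 : 2 ^ 2 ∣ N)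
    (ha₁ : W₀.a₁ = 0) (ha₃ : W₀.a₃ = 0) (hnb : ¬ HasNonBlindRationalTwoTorsion W₀) :
    D₀.maninConstant.natAbs = D₁.maninConstant.natAbs := by
  rcases shimuraLedgerAtFour_of_cusp_rational hF W₁ W₀ D₁ D₀ hiso h₁ h₀ h4 ha₁ ha₃ with h | ⟨_, h⟩
  · exact h
  · exact absurd h hnb

/-- On the same locus C2 for `D₀` ⟺ C2¹ for `D₁` (mod F★): the X₀-side and the X₁-side obligations coincide. -/
theorem maninOdd_iff_gammaOneOdd_of_not_hasNonBlind (hF : optimalGamma1Parametrization_cusp_rational)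
    {W₁ W₀ : WeierstrassCurve ℚ} [W₁.IsElliptic] [W₁.IsGloballyMinimal] [W₀.IsElliptic] [W₀.IsGloballyMinimal]
    {N : ℕ} [NeZero N] (D₁ : Gamma1ParametrizationData W₁ N) (D₀ : ModularParametrizationData W₀ N)
    (hiso : IsIsogenous W₁ W₀) (h₁ : D₁.IsOptimal)
    (h₀ : ∀ z ∈ D₀.L.lattice, ∃ w ∈ periodLattice D₀.f, z = D₀.c * w) (h4 : 2 ^ 2 ∣ N)
    (ha₁ : W₀.a₁ = 0) (ha₃ : W₀.a₃ = 0) (hnb : ¬ HasNonBlindRationalTwoTorsion W₀) :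
    ¬ (2 : ℤ) ∣ D₀.maninConstant ↔ ¬ (2 : ℤ) ∣ D₁.maninConstant := by
  have he := transfer_of_not_hasNonBlind hF D₁ D₀ hiso h₁ h₀ h4 ha₁ ha₃ hnb
  rw [← Int.dvd_natAbs, he, Int.dvd_natAbs]

end Summit.BirchSwinnertonDyer.Rank1Residual.ManinAdditive.ShimuraKernel

end
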